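import Mathlib.NumberTheory.LegendreSymbol.JacobiSymbol
import Mathlib.Tactic.NormNum.LegendreSymbol
import Mathlib.NumberTheory.ArithmeticFunction.Moebius
import Mathlib.NumberTheory.ArithmeticFunction.Misc
import Mathlib.NumberTheory.Bernoulli
import Literature.NumberTheory.LFunctions.GeneralizedBernoulliNumbers
import Literature.NumberTheory.QuadraticFields.FundamentalDiscriminant
import HarnessLib

/-!
# Cohen's numbers `H(r, N)` — the Fourier coefficients of the Cohen–Eisenstein series of weight `r + 1/2`

Topic `Literature/NumberTheory/ModularForms` (sub-namespace `CohenEisenstein`, naming the object). A DEFINITION file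
(definitions with bodies + their elementary API; NO named facts, no `instance`, no notation).

H. Cohen [Cohen1975, §2] attaches to every integer `r ≥ 1` the arithmetical function `N ↦ H(r, N)` (`N ≥ 0`):
* `H(r, N) = 0` unless `(−1)^r N ≡ 0, 1 (mod 4)`;
* `H(r, 0) = ζ(1 − 2r) = −B_{2r}/(2r)`;
* for `N > 0` with `(−1)^r N = D f²`, `D` a fundamental discriminant (including `D = 1`) and `f ≥ 1`:
  `H(r, N) = L(1 − r, χ_D) · Σ_{d ∣ f} μ(d) χ_D(d) d^{r−1} σ_{2r−1}(f/d)`, `χ_D = (D/·)` the Kronecker symbol,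
  `L(1 − r, χ_D) = −B_{r,χ_D}/r` (generalised Bernoulli number, `B_{r,χ} = |D|^{r−1} Σ_{c mod |D|} χ(c) B_r(c/|D|)`).
`H(1, N)` is the Hurwitz class number (`QuadraticFields/HurwitzClassNumber.lean`); Cohen's theorem [Cohen1975, Thm. 3.1] is that
`Σ_{N ≥ 0} H(r, N) qᴺ` is a modular form of weight `r + 1/2` on `Γ₀(4)` for `r ≥ 2` (NOT stated here). The same definition is
restated verbatim in the held secondary source [Ito2015, §3 (before Prop. 3.2)] (arXiv:1212.1392 p. 9).

What is here (tree vocabulary only: Mathlib `jacobiSym`, `Polynomial.bernoulli`, `bernoulli`, `ArithmeticFunction.moebius/sigma`,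
the tree's `genBernoulliCoeff` of `LFunctions/GeneralizedBernoulliNumbers.lean`, the fundamental-discriminant predicate spelled as in
`QuadraticFields/FundamentalDiscriminant.lean`):
* `chiDisc D n` — the Kronecker symbol `χ_D(n) = (D/n)` of a discriminant `D ≡ 0, 1 (mod 4)` at `n : ℕ`, written with Jacobi
  symbols: `(n/|D|)` when `D ≡ 1 (mod 4)` [MontgomeryVaughan2007, Thm. 9.13], and for `D ≡ 0 (mod 4)`: `0` at even `n`, `(D/n)` at odd `n`;
* `bernoulliDisc r D = B_{r,χ_D}`, `lValueDisc r D = −B_{r,χ_D}/r` (`= L(1 − r, χ_D)`, Washington Thm. 4.2), `cohenT r D f` (the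
  Möbius–divisor sum, an integer), `IsDiscDecomposition r N D f` (`(−1)^r N = D f²`, `D` fundamental or `1`, `f ≥ 1`),
  **`cohenH r N = H(r, N)`**;
* API: `cohenT_one` (`= 1` at `f = 1`), `cohenH_zero`, uniqueness of the decomposition `IsDiscDecomposition.unique` and the
  evaluation **`cohenH_eq`** (`H(r,N) = L(1−r,χ_D)·T` for ANY decomposition `(D, f)` supplied by the user), `cohenH_eq_zero_of_forall`,
  the bridge **`algebraMap_bernoulliDisc_eq_generalizedBernoulli`** to the tree's `generalizedBernoulli r ψ` for every Dirichlet
  character `ψ` mod `|D|` (values in any `ℚ`-algebra) whose values are `χ_D`, and shape lemmas for `chiDisc`.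
Deliberately NOT here: Cohen's modularity theorem, the alternative formula `H(r,N) = Σ_{d² ∣ N} h(r, N/d²)`, non-vanishing.

## References
* [Cohen1975] H. Cohen, *Sums involving the values at negative integers of L-functions of quadratic characters*, Math. Ann. 217
  (1975) 271–285, §2 (definition of `H(r, N)`), Thm. 3.1. (Not held; definition read in [Ito2015].)
* [Ito2015] A. Ito, *On certain infinite families of imaginary quadratic fields whose Iwasawa λ-invariant is equal to 1*, Acta Arith.
  168 (2015) = arXiv:1212.1392, §3 (held `paper:arxiv-1212.1392`, p. 9: the definition of `H(𝔯, N)` verbatim, Prop. 3.2 = Cohen's theorem).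
* [Washington1997] L. C. Washington, *Introduction to Cyclotomic Fields*, GTM 83, Prop. 4.1, Thm. 4.2 (`L(1−r,χ) = −B_{r,χ}/r`).
* [MontgomeryVaughan2007] H. L. Montgomery, R. C. Vaughan, *Multiplicative Number Theory I*, §9.3, Thm. 9.13 (Kronecker symbol of a
  fundamental discriminant as a Jacobi symbol).
-/

noncomputable section

open scoped NumberTheorySymbols ArithmeticFunction.Moebius ArithmeticFunction.sigma Classical
open Finset ArithmeticFunction

namespace Literature.NumberTheory.ModularForms.CohenEisenstein

open Literature.NumberTheory.LFunctions (genBernoulliCoeff genBernoulliCoeff_of_one_le generalizedBernoulli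
  generalizedBernoulli_eq_sum)

/-! ## The Kronecker symbol of a discriminant -/

/-- **`χ_D(n) = (D/n)`, the Kronecker symbol of a discriminant `D` (`D ≡ 0, 1 (mod 4)`) at `n : ℕ`**, as an integer, through
Mathlib's Jacobi symbol: for `D ≡ 1 (mod 4)` it is `(n/|D|)` (quadratic reciprocity with the supplements; this covers even `n` and
`D = 1`, where it is identically `1`), and for `D ≡ 0 (mod 4)` it is `0` at even `n` and the Jacobi symbol `(D/n)` at odd `n`.
(Only the values at discriminants `D` are meaningful; this is the `χ_D(d)` of Cohen's formula.)
[cite: MontgomeryVaughan2007, Thm. 9.13] -/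
def chiDisc (D : ℤ) (n : ℕ) : ℤ :=
  if D % 4 = 1 then J((n : ℤ) | D.natAbs) else if Even n then 0 else J(D | n)

/-- Shape of `chiDisc` for `D ≡ 1 (mod 4)`: `χ_D(n) = (n/|D|)`. [cite: MontgomeryVaughan2007, Thm. 9.13] -/
theorem chiDisc_of_emod_four_eq_one {D : ℤ} (hD : D % 4 = 1) (n : ℕ) : chiDisc D n = J((n : ℤ) | D.natAbs) := by
  rw [chiDisc, if_pos hD]

/-- Shape of `chiDisc` for `D ≢ 1 (mod 4)` at odd `n`: `χ_D(n) = (D/n)` (Jacobi symbol). [cite: MontgomeryVaughan2007, Thm. 9.13] -/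
theorem chiDisc_of_emod_four_ne_one_of_odd {D : ℤ} (hD : D % 4 ≠ 1) {n : ℕ} (hn : Odd n) :
    chiDisc D n = J(D | n) := by
  rw [chiDisc, if_neg hD, if_neg (Nat.not_even_iff_odd.mpr hn)]

/-- Shape of `chiDisc` for `D ≢ 1 (mod 4)` at even `n`: `χ_D(n) = 0`. [cite: MontgomeryVaughan2007, Thm. 9.13] -/
theorem chiDisc_of_emod_four_ne_one_of_even {D : ℤ} (hD : D % 4 ≠ 1) {n : ℕ} (hn : Even n) : chiDisc D n = 0 := by
  rw [chiDisc, if_neg hD, if_pos hn]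

/-- `χ_D(1) = 1`. [cite: MontgomeryVaughan2007, Thm. 9.13] -/
theorem chiDisc_one_right (D : ℤ) : chiDisc D 1 = 1 := by
  unfold chiDisc
  split_ifs with h1 h2
  · rw [Nat.cast_one, jacobiSym.one_left]
  · exact absurd h2 (by decide)
  · exact jacobiSym.one_right D

/-- `χ_1 ≡ 1` (the trivial character: the case `D = 1` of Cohen's formula, `(−1)^r N` a perfect square).
[cite: Cohen1975, §2 (definition of H(r, N))] -/
theorem chiDisc_one_left (n : ℕ) : chiDisc 1 n = 1 := by
  rw [chiDisc_of_emod_four_eq_one (by decide), Int.natAbs_one, jacobiSym.one_right]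

/-- The values of `χ_D` lie in `{0, 1, −1}`. [cite: MontgomeryVaughan2007, Thm. 9.13] -/
theorem chiDisc_trichotomy (D : ℤ) (n : ℕ) : chiDisc D n = 0 ∨ chiDisc D n = 1 ∨ chiDisc D n = -1 := by
  unfold chiDisc
  split_ifs
  · exact jacobiSym.trichotomy _ _
  · exact Or.inl rfl
  · exact jacobiSym.trichotomy _ _

/-! ## `B_{r,χ_D}`, `L(1 − r, χ_D)` and the Möbius–divisor sum -/

/-- **`B_{r,χ_D} = |D|^{r−1} Σ_{c=0}^{|D|−1} χ_D(c) B_r(c/|D|)`**, the generalised Bernoulli number of the Kronecker symbol `χ_D`,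
as a rational number (the weights `|D|^{r−1} B_r(c/|D|)` are the tree's `genBernoulliCoeff r |D| c`; for `D = 1` this is `B_r`).
[cite: Washington1997, Prop. 4.1] -/
def bernoulliDisc (r : ℕ) (D : ℤ) : ℚ :=
  ∑ c ∈ range D.natAbs, (chiDisc D c : ℚ) * genBernoulliCoeff r D.natAbs c

/-- **`L(1 − r, χ_D) := −B_{r,χ_D}/r`** as a rational number (Washington Thm. 4.2: the value of the Dirichlet `L`-function of
`χ_D` at `1 − r`, `r ≥ 1`; with Mathlib's `B₁ = −1/2` the only mismatch would be `r = 1, D = 1`, which never occurs in Cohen's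
formula since `−N < 0` is not a square). [cite: Washington1997, Thm. 4.2] -/
def lValueDisc (r : ℕ) (D : ℤ) : ℚ := -bernoulliDisc r D / r

/-- **Cohen's divisor sum `T_r(D, f) = Σ_{d ∣ f} μ(d) χ_D(d) d^{r−1} σ_{2r−1}(f/d)`** (an integer; `= 1` at `f = 1`).
[cite: Cohen1975, §2 (definition of H(r, N))] -/
def cohenT (r : ℕ) (D : ℤ) (f : ℕ) : ℤ :=
  ∑ d ∈ f.divisors, μ d * chiDisc D d * (d : ℤ) ^ (r - 1) * (σ (2 * r - 1) (f / d) : ℤ)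

/-- `T_r(D, 1) = 1`. [cite: Cohen1975, §2 (definition of H(r, N))] -/
theorem cohenT_one (r : ℕ) (D : ℤ) : cohenT r D 1 = 1 := by
  simp [cohenT, Nat.divisors_one, chiDisc_one_right, ArithmeticFunction.sigma_apply]

/-- **`(−1)^r N = D f²` with `D` a fundamental discriminant or `1` and `f ≥ 1`** — the decomposition through which Cohen defines
`H(r, N)` for `N > 0` (the fundamental-discriminant predicate is spelled as in `QuadraticFields/FundamentalDiscriminant.lean`:
`D ≡ 1 (mod 4)` squarefree `≠ 1`, or `D = 4m`, `m ≡ 2, 3 (mod 4)` squarefree). [cite: Cohen1975, §2 (definition of H(r, N))] -/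
def IsDiscDecomposition (r N : ℕ) (D : ℤ) (f : ℕ) : Prop :=
  (D = 1 ∨ (D % 4 = 1 ∧ Squarefree D ∧ D ≠ 1) ∨ (4 ∣ D ∧ (D / 4 % 4 = 2 ∨ D / 4 % 4 = 3) ∧ Squarefree (D / 4))) ∧
    0 < f ∧ (-1 : ℤ) ^ r * N = D * (f : ℤ) ^ 2

/-! ## Cohen's `H(r, N)` -/

/-- **Cohen's number `H(r, N)`** (`r ≥ 1`, `N ≥ 0`): `H(r, 0) = ζ(1 − 2r) = −B_{2r}/(2r)`; for `N > 0` with `(−1)^r N = D f²`,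
`D` a fundamental discriminant or `1`, `f ≥ 1` (such a pair is unique, `IsDiscDecomposition.unique`; one is CHOSEN here and
`cohenH_eq` evaluates at any): `H(r, N) = L(1 − r, χ_D) Σ_{d ∣ f} μ(d) χ_D(d) d^{r−1} σ_{2r−1}(f/d)`; and `H(r, N) = 0` when no such
decomposition exists, i.e. when `(−1)^r N ≡ 2, 3 (mod 4)`. These are the Fourier coefficients of the Cohen–Eisenstein series
`H_r = Σ_N H(r, N) qᴺ` of weight `r + 1/2` on `Γ₀(4)`. [cite: Cohen1975, §2 (definition of H(r, N))] -/
def cohenH (r N : ℕ) : ℚ :=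
  if N = 0 then -bernoulli (2 * r) / (2 * r)
  else if h : ∃ Df : ℤ × ℕ, IsDiscDecomposition r N Df.1 Df.2 then lValueDisc r h.choose.1 * cohenT r h.choose.1 h.choose.2
  else 0

/-- `H(r, 0) = ζ(1 − 2r) = −B_{2r}/(2r)`. [cite: Cohen1975, §2 (definition of H(r, N))] -/
theorem cohenH_zero (r : ℕ) : cohenH r 0 = -bernoulli (2 * r) / (2 * r) := by
  rw [cohenH, if_pos rfl]

/-- `H(r, N) = 0` when `(−1)^r N` admits no decomposition `D f²` (`D` fundamental or `1`), e.g. when `(−1)^r N ≡ 2, 3 (mod 4)`.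
[cite: Cohen1975, §2 (definition of H(r, N))] -/
theorem cohenH_eq_zero_of_forall {r N : ℕ} (hN : N ≠ 0) (h : ∀ (D : ℤ) (f : ℕ), ¬ IsDiscDecomposition r N D f) :
    cohenH r N = 0 := by
  rw [cohenH, if_neg hN, dif_neg]
  rintro ⟨Df, hDf⟩
  exact h Df.1 Df.2 hDf

/-- `D f² ≡ 0, 1 (mod 4)` for a discriminant `D`; hence `H(r, N) = 0` when `(−1)^r N ≡ 2` or `3 (mod 4)`.
[cite: Cohen1975, §2 (definition of H(r, N))] -/
theorem cohenH_eq_zero_of_emod_four {r N : ℕ} (hN : N ≠ 0)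
    (h4 : ((-1 : ℤ) ^ r * N) % 4 = 2 ∨ ((-1 : ℤ) ^ r * N) % 4 = 3) : cohenH r N = 0 := by
  refine cohenH_eq_zero_of_forall hN fun D f hDf => ?_
  obtain ⟨hD, -, hM⟩ := hDf
  rw [hM] at h4
  -- `D ≡ 0, 1 (mod 4)` and squares are `≡ 0, 1 (mod 4)`
  have hD4 : D % 4 = 0 ∨ D % 4 = 1 := by
    rcases hD with rfl | ⟨h1, -, -⟩ | ⟨h0, -, -⟩
    · exact Or.inr (by decide)
    · exact Or.inr h1
    · exact Or.inl (Int.emod_eq_zero_of_dvd h0)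
  have hsq : ((f : ℤ) ^ 2) % 4 = 0 ∨ ((f : ℤ) ^ 2) % 4 = 1 := by
    rcases Int.even_or_odd' (f : ℤ) with ⟨k, hk | hk⟩ <;> rw [hk]
    · left; rw [show (2 * k) ^ 2 = 4 * k ^ 2 by ring]; simp
    · right; rw [show (2 * k + 1) ^ 2 = 1 + 4 * (k ^ 2 + k) by ring, Int.add_mul_emod_self_left]; decide
  have : (D * (f : ℤ) ^ 2) % 4 = 0 ∨ (D * (f : ℤ) ^ 2) % 4 = 1 := by
    rw [Int.mul_emod]
    rcases hD4 with h | h <;> rcases hsq with h' | h' <;> rw [h, h'] <;> decide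
  omega

/-! ### Uniqueness of the decomposition `(−1)^r N = D f²` -/

/-- A fundamental discriminant is not a perfect square. [folklore] -/
private theorem not_sq_eq_of_isFundamental {D : ℤ}
    (hD : (D % 4 = 1 ∧ Squarefree D ∧ D ≠ 1) ∨ (4 ∣ D ∧ (D / 4 % 4 = 2 ∨ D / 4 % 4 = 3) ∧ Squarefree (D / 4)))
    (n : ℤ) : n ^ 2 ≠ D := by
  intro hn
  rcases Literature.NumberTheory.QuadraticFields.Quadratic.sq_eq_one_or_four_of_sq_dvd hD ⟨1, by rw [hn, mul_one]⟩ with h1 | h4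
  · rcases hD with ⟨-, -, hne⟩ | ⟨h4, -, -⟩
    · exact hne (by rw [← hn, h1])
    · rw [← hn, h1] at h4; norm_num at h4
  · rcases hD with ⟨h1, -, -⟩ | ⟨-, hm4, -⟩
    · rw [← hn, h4] at h1; norm_num at h1
    · rw [← hn, h4] at hm4; norm_num at hm4

/-- **Uniqueness of the decomposition**: if `(−1)^r N = D f² = D' f'²` with `D, D'` fundamental discriminants or `1` and
`f, f' ≥ 1`, then `D = D'` and `f = f'` (two fundamental discriminants differing by a rational square are equal,
`Quadratic.eq_of_isFundamental_of_eq_mul_sq`; a fundamental discriminant is not a square) — the well-definedness of Cohen's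
`H(r, N)`. [cite: Cohen1975, §2 (definition of H(r, N))] -/
theorem IsDiscDecomposition.unique {r N : ℕ} {D D' : ℤ} {f f' : ℕ} (h : IsDiscDecomposition r N D f)
    (h' : IsDiscDecomposition r N D' f') : D = D' ∧ f = f' := by
  obtain ⟨hD, hf, hM⟩ := h
  obtain ⟨hD', hf', hM'⟩ := h'
  have hff : (D : ℚ) * (f : ℚ) ^ 2 = D' * (f' : ℚ) ^ 2 := by exact_mod_cast hM.symm.trans hM'
  have hf0 : (f : ℚ) ≠ 0 := by exact_mod_cast hf.ne'
  have hf0' : (f' : ℚ) ≠ 0 := by exact_mod_cast hf'.ne'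
  have hDD : D = D' := by
    rcases hD with rfl | hD <;> rcases hD' with rfl | hD'
    · rfl
    · -- `f² = D' f'²`: `D'` would be a square
      exfalso
      have hq : (D' : ℚ) = ((f : ℚ) / f') ^ 2 := by
        field_simp
        push_cast at hff ⊢
        linarith [hff]
      obtain ⟨n, hn⟩ : ∃ n : ℤ, (n : ℚ) = (f : ℚ) / f' := by
        have hint : IsIntegral ℤ ((f : ℚ) / f') := by
          refine ⟨Polynomial.X ^ 2 - Polynomial.C D', by monicity!, ?_⟩
          simp only [Polynomial.eval₂_sub, Polynomial.eval₂_X_pow]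
          rw [Polynomial.eval₂_C, eq_intCast, ← hq, sub_self]
        obtain ⟨n, hn⟩ := IsIntegrallyClosed.isIntegral_iff.mp hint
        exact ⟨n, by rw [← hn, eq_intCast]⟩
      refine not_sq_eq_of_isFundamental hD' n ?_
      exact_mod_cast (show ((n : ℚ)) ^ 2 = D' by rw [hn, ← hq])
    · exfalso
      have hq : (D : ℚ) = ((f' : ℚ) / f) ^ 2 := by
        field_simp
        push_cast at hff ⊢
        linarith [hff]
      obtain ⟨n, hn⟩ : ∃ n : ℤ, (n : ℚ) = (f' : ℚ) / f := by
        have hint : IsIntegral ℤ ((f' : ℚ) / f) := by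
          refine ⟨Polynomial.X ^ 2 - Polynomial.C D, by monicity!, ?_⟩
          simp only [Polynomial.eval₂_sub, Polynomial.eval₂_X_pow]
          rw [Polynomial.eval₂_C, eq_intCast, ← hq, sub_self]
        obtain ⟨n, hn⟩ := IsIntegrallyClosed.isIntegral_iff.mp hint
        exact ⟨n, by rw [← hn, eq_intCast]⟩
      refine not_sq_eq_of_isFundamental hD n ?_
      exact_mod_cast (show ((n : ℚ)) ^ 2 = D by rw [hn, ← hq])
    · exact Literature.NumberTheory.QuadraticFields.Quadratic.eq_of_isFundamental_of_eq_mul_sq hD hD' (q := (f' : ℚ) / f) (by field_simp; linarith [hff])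
  subst hDD
  refine ⟨rfl, ?_⟩
  have hD0 : (D : ℚ) ≠ 0 := by
    rcases hD with rfl | hD
    · norm_num
    · exact_mod_cast fun h0 => not_sq_eq_of_isFundamental hD 0 (by rw [h0]; ring)
  have hsq : ((f : ℚ)) ^ 2 = (f' : ℚ) ^ 2 := mul_left_cancel₀ hD0 hff
  have := (sq_eq_sq₀ (by positivity) (by positivity)).mp hsq
  exact_mod_cast this

/-- **Evaluation of `H(r, N)` at a decomposition**: if `(−1)^r N = D f²` with `D` a fundamental discriminant or `1` and `f ≥ 1`,
then `H(r, N) = L(1 − r, χ_D) · Σ_{d ∣ f} μ(d) χ_D(d) d^{r−1} σ_{2r−1}(f/d)`. [cite: Cohen1975, §2 (definition of H(r, N))] -/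
theorem cohenH_eq {r N : ℕ} {D : ℤ} {f : ℕ} (h : IsDiscDecomposition r N D f) :
    cohenH r N = lValueDisc r D * cohenT r D f := by
  have hN : N ≠ 0 := by
    rintro rfl
    obtain ⟨hD, hf, hM⟩ := h
    simp only [Nat.cast_zero, mul_zero] at hM
    have hD0 : D ≠ 0 := by
      rcases hD with rfl | hD
      · exact one_ne_zero
      · exact fun h0 => not_sq_eq_of_isFundamental hD 0 (by rw [h0]; ring)
    have : (f : ℤ) ^ 2 ≠ 0 := pow_ne_zero _ (by exact_mod_cast hf.ne')
    exact this ((mul_eq_zero.mp hM.symm).resolve_left hD0)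
  have hex : ∃ Df : ℤ × ℕ, IsDiscDecomposition r N Df.1 Df.2 := ⟨(D, f), h⟩
  rw [cohenH, if_neg hN, dif_pos hex]
  obtain ⟨hD, hf⟩ := hex.choose_spec.unique h
  rw [hD, hf]

/-- `H(r, N) = L(1 − r, χ_D)` when `(−1)^r N = D` is itself a fundamental discriminant (`f = 1`).
[cite: Cohen1975, §2 (definition of H(r, N))] -/
theorem cohenH_eq_lValueDisc {r N : ℕ} {D : ℤ} (h : IsDiscDecomposition r N D 1) : cohenH r N = lValueDisc r D := by
  rw [cohenH_eq h, cohenT_one, Int.cast_one, mul_one]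

/-! ### Two values from Cohen's table of `H_2 = 1/120 − q/12 − 7q⁴/12 − 2q⁵/5 − q⁸ − ⋯` (non-vacuity) -/

/-- `B₂(x) = x² − x + 1/6`. [folklore] -/
private theorem bernoulli_two_eval (x : ℚ) : (Polynomial.bernoulli 2).eval x = x ^ 2 - x + 1 / 6 := by
  rw [Polynomial.bernoulli_def]
  simp only [sum_range_succ, sum_range_zero, Polynomial.eval_add, Polynomial.eval_monomial]
  norm_num
  ring

/-- **`H(2, 5) = L(−1, χ_5) = −2/5`** (`5` is a fundamental discriminant, `f = 1`; `B_{2,χ_5} = 5·Σ_c χ_5(c)B₂(c/5) = 4/5`) —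
the coefficient of `q⁵` in Cohen's `H_2`. [cite: Cohen1975, §2 (definition of H(r, N))] -/
theorem cohenH_two_five : cohenH 2 5 = -2 / 5 := by
  have h5 : Squarefree (5 : ℤ) := Int.squarefree_natCast.mpr Nat.prime_five.prime.squarefree
  have h : IsDiscDecomposition 2 5 5 1 := ⟨Or.inr (Or.inl ⟨by decide, h5, by decide⟩), one_pos, by norm_num⟩
  rw [cohenH_eq_lValueDisc h, lValueDisc, bernoulliDisc]
  simp only [show (5 : ℤ).natAbs = 5 from rfl, sum_range_succ, sum_range_zero, chiDisc_of_emod_four_eq_one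
    (show (5 : ℤ) % 4 = 1 by decide), genBernoulliCoeff_of_one_le (show 1 ≤ 2 by norm_num), bernoulli_two_eval]
  norm_num

/-- **`H(2, 4) = −7/12`** (`4 = 1 · 2²`: `D = 1`, `f = 2`; `L(−1, χ_1) = ζ(−1) = −1/12` and
`T = σ₃(2) − 2σ₃(1) = 7`) — the coefficient of `q⁴` in Cohen's `H_2`. [cite: Cohen1975, §2 (definition of H(r, N))] -/
theorem cohenH_two_four : cohenH 2 4 = -7 / 12 := by
  have h : IsDiscDecomposition 2 4 1 2 := ⟨Or.inl rfl, two_pos, by norm_num⟩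
  rw [cohenH_eq h, lValueDisc, bernoulliDisc, cohenT]
  have hμ : μ 2 = -1 := ArithmeticFunction.moebius_apply_prime Nat.prime_two
  simp only [Int.natAbs_one, sum_range_succ, sum_range_zero, chiDisc_one_left, show Nat.divisors 2 = {1, 2} by decide,
    genBernoulliCoeff_of_one_le (show 1 ≤ 2 by norm_num), bernoulli_two_eval]
  norm_num [ArithmeticFunction.sigma_apply, show Nat.divisors 2 = {1, 2} by decide, hμ]

/-! ### The bridge to the tree's `generalizedBernoulli` -/

/-- Sums over `ZMod n` through the representatives `0 ≤ j.val < n`. [folklore] -/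
private theorem sum_zmod_val_eq_sum_range {M : Type*} [AddCommMonoid M] (n : ℕ) [NeZero n] (g : ℕ → M) :
    ∑ j : ZMod n, g j.val = ∑ c ∈ range n, g c := by
  cases n with
  | zero => exact absurd rfl (NeZero.ne 0)
  | succ n => exact Fin.sum_univ_eq_sum_range (fun c => g c) (n + 1)

/-- **`B_{r,χ_D}` is the generalised Bernoulli number of any Dirichlet character with the values `χ_D`.** For a `ℚ`-algebra `R`
and a Dirichlet character `ψ` modulo `|D|` with `ψ(c) = χ_D(c)` for all `c : ℕ`, the tree's `generalizedBernoulli r ψ`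
(Diamond–Shurman (4.30)) is the image of `bernoulliDisc r D`. This is how `H(r, N)` is read in `ℚ_p` (or `ℂ`) against a
`ℚ_p`-valued (or complex) Kronecker character characterised by its values. [cite: Washington1997, Prop. 4.1] -/
theorem algebraMap_bernoulliDisc_eq_generalizedBernoulli {R : Type*} [CommRing R] [Algebra ℚ R] (r : ℕ) {D : ℤ}
    [NeZero D.natAbs] (ψ : DirichletCharacter R D.natAbs) (hψ : ∀ c : ℕ, ψ (c : ZMod D.natAbs) = (chiDisc D c : R)) :
    algebraMap ℚ R (bernoulliDisc r D) = generalizedBernoulli r ψ := by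
  rw [generalizedBernoulli_eq_sum, bernoulliDisc, map_sum]
  rw [← sum_zmod_val_eq_sum_range D.natAbs (fun c => algebraMap ℚ R ((chiDisc D c : ℚ) * genBernoulliCoeff r D.natAbs c))]
  refine sum_congr rfl fun j _ => ?_
  rw [map_mul, map_intCast, ← hψ j.val, ZMod.natCast_zmod_val]

/-- The same bridge for `L(1 − r, χ_D) = −B_{r,χ_D}/r`: `algebraMap ℚ R (lValueDisc r D) = −(r : R)⁻¹ · B_{r,ψ}` whenever
`r` is invertible in `R` (e.g. `R` a field of characteristic `0`). [cite: Washington1997, Thm. 4.2] -/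
theorem algebraMap_lValueDisc {R : Type*} [Field R] [CharZero R] [Algebra ℚ R] (r : ℕ) {D : ℤ} [NeZero D.natAbs]
    (ψ : DirichletCharacter R D.natAbs) (hψ : ∀ c : ℕ, ψ (c : ZMod D.natAbs) = (chiDisc D c : R)) :
    algebraMap ℚ R (lValueDisc r D) = -((r : R)⁻¹ * generalizedBernoulli r ψ) := by
  rw [lValueDisc, map_div₀, map_neg, map_natCast, algebraMap_bernoulliDisc_eq_generalizedBernoulli r ψ hψ]
  ring

end Literature.NumberTheory.ModularForms.CohenEisenstein

end
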